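import Summits.AtomisticToContinuum.Crystallization.Theorems.ExcessDecayLiouvillePhononStabilityDefs
import Summits.AtomisticToContinuum.Crystallization.Theorems.ExcessDecayLiouvillePhononStabilityTail
import Summits.AtomisticToContinuum.Crystallization.Theorems.ExcessDecayLiouvillePhononStabilityPullbackBonds
import Summits.AtomisticToContinuum.Crystallization.Theorems.ExcessDecayLiouvillePhononStabilityFarDefs

/-!
# `PhononStability` (stmt-AtomisticToContinuum-9333), line `contragredient-window-collapse`: stub `stub_farControl`

Sub-goal S10 of the reshaped line (`FarControl`, the THREE-RANGE far field in `tsum` form): given the chain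
bound (S6) and the path bound (S7), ranges `2 ≤ Rn ≤ Rf ≤ R∞`, a valid chain assignment on `(Rn, Rf]`, a
mid-range assignment `P` (`MidBound Rf R∞ P`), the summability of the far-far lattice constant beyond `R∞`,
a window cell `A`, a shift error `δ` and a finitely supported label field `w` with summable class family,

`−chargeSum Rn Rf chain A δ w − (Σ_{c ∈ (Rf, R∞]} farCoeff c · P c)·N0 w − farTailConst R∞ · N0 w
    ≤ Σ'_{‖ζ⁰_c‖ > Rn} classTerm A B δ w c`.

* **Range `(Rn, Rf]`** (`neg_abs_mul_chainCharge_le`): a class `c ∉ classesR Rn` has `‖ζ⁰_c‖ > Rn ≥ 2`,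
  is non-diagonal, and on the window its actual length is `‖Aζ_c(δ)‖ ≥ (23/25)‖ζ⁰_c‖ > 1`; hence
  `ψ(‖Aζ_c‖) ≥ 0` is dropped (`metricForm ≥ 0`), `ω·X_c ≥ −|ω|·X_c`, and the chain bound with weights
  `‖ζ⁰_s‖ ≥ 1` along the valid chain gives `X_c ≤ chainCharge δ c (chain c) w`.
* **Range `(Rf, R∞]`** (`neg_farCoeff_mul_P_le`): the landed far-bond bound
  `classTerm_c ≥ −farCoeff c · plainForm c w` (`TailStub.neg_farCoeff_mul_le` at range `Rf`) and the
  mid-range assignment `plainForm c w ≤ P c · N0 w`.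
* **Beyond `R∞`** (`neg_farCoeff_mul_pathConst_le`): the same far-bond bound at range `R∞` and the path bound
  `plainForm c w ≤ pathConst c · N0 w`.
* **Bookkeeping** (`stub_farControl`): the far family is the summable class family minus a finitely supported
  one; the three charge families are finitely supported / finitely supported / the summable far-far constant
  family times `N0 w`; the ranges are nested (`classesR_mono`, via box coverage) and the pointwise three-range
  bound (`pointwise_bound`) is summed by `Summable.tsum_le_tsum`.

All `[folklore]`.
-/

noncomputable section

open scoped BigOperators Classical InnerProductSpace
open Filter Set Function
open Literature.MathematicalPhysics.StatisticalMechanics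
open Summit.AtomisticToContinuum.Crystallization.Theses.ExcessDecayLiouville
open Summit.AtomisticToContinuum.Crystallization.Theorems.PhononStabilityNegative
open Summit.AtomisticToContinuum.Crystallization.Theorems.PhononStabilityCWC

namespace Summit.AtomisticToContinuum.Crystallization.Theorems.PhononStabilityCWC.FarControlStub

/-! ## Copies of the line's Basics lemmas (not in the tree) -/

/-- `X_c ≥ 0`; copy of the line's Basics lemma. [folklore] -/
private theorem longForm_nonneg (δ : EuclideanSpace ℝ (Fin 3)) (c : BondClass)
    (w : Label → EuclideanSpace ℝ (Fin 3)) : 0 ≤ longForm δ c w :=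
  tsum_nonneg fun _ => by positivity

/-- `Y_c ≥ 0`; copy of the line's Basics lemma. [folklore] -/
private theorem metricForm_nonneg (B : EuclideanSpace ℝ (Fin 3) →L[ℝ] EuclideanSpace ℝ (Fin 3))
    (c : BondClass) (w : Label → EuclideanSpace ℝ (Fin 3)) : 0 ≤ metricForm B c w :=
  tsum_nonneg fun _ => by positivity

/-- `farCoeff ≥ 0`; copy of the line's Basics lemma. [folklore] -/
private theorem farCoeff_nonneg (c : BondClass) : 0 ≤ farCoeff c := by
  unfold farCoeff; positivity

/-! ## Ranges: membership, nesting, non-diagonality -/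

/-- Membership in the exact range: `c ∈ classesR R ↔ c ∈ classBox R ∧ ‖ζ⁰_c‖ ≤ R`. [folklore] -/
theorem mem_classesR {R : ℝ} {c : BondClass} : c ∈ classesR R ↔ c ∈ classBox R ∧ ‖bondVec 0 c‖ ≤ R := by
  unfold classesR
  rw [Finset.mem_filter]

/-- Membership in a far range: `c ∈ farClasses Rn Rf ↔ c ∈ classesR Rf ∧ c ∉ classesR Rn`. [folklore] -/
theorem mem_farClasses {Rn Rf : ℝ} {c : BondClass} :
    c ∈ farClasses Rn Rf ↔ c ∈ classesR Rf ∧ c ∉ classesR Rn := by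
  unfold farClasses
  rw [Finset.mem_filter]

/-- **Nesting of the exact ranges:** `classesR R ⊆ classesR R'` for `R ≤ R'` (re-boxing by box coverage).
[folklore] -/
theorem classesR_mono {R R' : ℝ} (h : R ≤ R') {c : BondClass} (hc : c ∈ classesR R) : c ∈ classesR R' := by
  have h1 : ‖bondVec 0 c‖ ≤ R' := (mem_classesR.mp hc).2.trans h
  exact mem_classesR.mpr ⟨TailStub.mem_classBox_of_norm_le h1, h1⟩

/-- The diagonal class has zero bond vector. [folklore] -/
private theorem bondVec_diag (δ : EuclideanSpace ℝ (Fin 3)) {c : BondClass} (hc : diagClass c) : bondVec δ c = 0 := by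
  obtain ⟨m, m', n⟩ := c
  obtain ⟨h1, h2⟩ := hc
  simp only at h1 h2
  subst h1; subst h2
  simp [bondVec]

/-- Classes outside `classesR R`, `R ≥ 0`, are non-diagonal (`‖ζ⁰_c‖ > R ≥ 0 = ‖ζ⁰_diag‖`). [folklore] -/
theorem not_diagClass_of_notMem {R : ℝ} (hR : 0 ≤ R) {c : BondClass} (hc : c ∉ classesR R) :
    ¬ diagClass c := by
  intro hd
  have h := TailStub.lt_norm_of_notMem hc
  rw [bondVec_diag 0 hd, norm_zero] at h
  linarith

/-- On the window a class outside `classesR R`, `R ≥ 2`, has actual length `‖Aζ_c(δ)‖ ≥ (23/25)·2 > 1`, hence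
`ψ(‖Aζ_c(δ)‖) = r⁻⁸ − r⁻¹⁴ ≥ 0`. [folklore] -/
theorem psiLJ_nonneg_of_notMem {R : ℝ} (hR : 2 ≤ R)
    {A : EuclideanSpace ℝ (Fin 3) →L[ℝ] EuclideanSpace ℝ (Fin 3)} {δ : EuclideanSpace ℝ (Fin 3)}
    (hW : CellWindow A) (hδ : ShiftWindow A δ) {c : BondClass} (hc : c ∉ classesR R) :
    0 ≤ psiLJ ‖A (bondVec δ c)‖ := by
  have hρ := TailStub.lt_norm_of_notMem hc
  have hnd := not_diagClass_of_notMem (by linarith) hc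
  have h1 := (PullbackStub.norm_map_bondVec_ge hW hδ hnd).1
  have hr1 : 1 ≤ ‖A (bondVec δ c)‖ := by linarith
  have hi0 : 0 ≤ ‖A (bondVec δ c)‖⁻¹ := inv_nonneg.mpr (norm_nonneg _)
  have hi1 : ‖A (bondVec δ c)‖⁻¹ ≤ 1 := inv_le_one_of_one_le₀ hr1
  have : ‖A (bondVec δ c)‖⁻¹ ^ 14 ≤ ‖A (bondVec δ c)‖⁻¹ ^ 8 := pow_le_pow_of_le_one hi0 hi1 (by norm_num)
  unfold psiLJ
  linarith

/-! ## The three ranges -/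

/-- `X_c(δ, w) = dirForm (ζ_c(δ)) c w` (definitional). [folklore] -/
theorem longForm_eq_dirForm (δ : EuclideanSpace ℝ (Fin 3)) (c : BondClass) (w : Label → EuclideanSpace ℝ (Fin 3)) :
    longForm δ c w = dirForm (bondVec δ c) c w := rfl

/-- **Chain charge dominates the longitudinal functional** on `(Rn, Rf]`: for a valid chain assignment,
`X_c(δ, w) ≤ chainCharge δ c (chain c) w` (the chain bound with weights `wt s = ‖ζ⁰_s‖`, positive since the
steps are non-diagonal, `‖ζ⁰_s‖ ≥ 1`). [folklore] -/
theorem longForm_le_chainCharge (hC : ChainBound) {Rn Rf : ℝ} {chain : BondClass → List BondClass}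
    (hvalid : ValidChains Rn Rf chain) (δ : EuclideanSpace ℝ (Fin 3))
    {w : Label → EuclideanSpace ℝ (Fin 3)} (hw : (support w).Finite) {c : BondClass}
    (hc : c ∈ farClasses Rn Rf) : longForm δ c w ≤ chainCharge δ c (chain c) w := by
  obtain ⟨hch, hnd⟩ := hvalid c hc
  have hpos : ∀ s ∈ chain c, 0 < (fun s : BondClass => ‖bondVec 0 s‖) s := fun s hs =>
    lt_of_lt_of_le one_pos (PullbackStub.one_le_norm_bondVec_zero (hnd s hs))
  have h := hC c (chain c) hch (fun s => ‖bondVec 0 s‖) hpos (bondVec δ c) w hw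
  rw [longForm_eq_dirForm]
  exact h

/-- **Range `(Rn, Rf]`:** `classTerm_c ≥ −|ω(‖Aζ_c(δ)‖)|·chainCharge δ c (chain c) w`
(`ψ ≥ 0`, `Y_c ≥ 0`, `X_c ≥ 0`, `ω·X_c ≥ −|ω|·X_c`, `X_c ≤ chainCharge`). [folklore] -/
theorem neg_abs_mul_chainCharge_le (hC : ChainBound) {Rn Rf : ℝ} (hRn : 2 ≤ Rn)
    {chain : BondClass → List BondClass} (hvalid : ValidChains Rn Rf chain)
    {A B : EuclideanSpace ℝ (Fin 3) →L[ℝ] EuclideanSpace ℝ (Fin 3)} {δ : EuclideanSpace ℝ (Fin 3)}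
    {w : Label → EuclideanSpace ℝ (Fin 3)} (hW : CellWindow A) (hδ : ShiftWindow A δ)
    (hw : (support w).Finite) {c : BondClass} (hc : c ∈ farClasses Rn Rf) :
    -(|omegaLJ ‖A (bondVec δ c)‖| * chainCharge δ c (chain c) w) ≤ classTerm A B δ w c := by
  have hcn : c ∉ classesR Rn := (mem_farClasses.mp hc).2
  have hψ := psiLJ_nonneg_of_notMem hRn hW hδ hcn
  have hX := longForm_le_chainCharge hC hvalid δ hw hc
  have hL := longForm_nonneg δ c w
  have hM := metricForm_nonneg B c w
  have h1 : -|omegaLJ ‖A (bondVec δ c)‖| * longForm δ c w ≤ omegaLJ ‖A (bondVec δ c)‖ * longForm δ c w :=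
    mul_le_mul_of_nonneg_right (neg_abs_le _) hL
  have h2 : |omegaLJ ‖A (bondVec δ c)‖| * longForm δ c w ≤
      |omegaLJ ‖A (bondVec δ c)‖| * chainCharge δ c (chain c) w :=
    mul_le_mul_of_nonneg_left hX (abs_nonneg _)
  have h3 := mul_nonneg hψ hM
  unfold classTerm
  linarith

/-- **Range `(Rf, R∞]`:** `classTerm_c ≥ −farCoeff c · P c · N0 w` (the landed far-bond bound at range `Rf` and the
mid-range assignment `plainForm c w ≤ P c · N0 w`, `farCoeff ≥ 0`). [folklore] -/
theorem neg_farCoeff_mul_P_le {Rf Rinf : ℝ} (hRf : 2 ≤ Rf) {P : BondClass → ℝ} (hmid : MidBound Rf Rinf P)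
    {A B : EuclideanSpace ℝ (Fin 3) →L[ℝ] EuclideanSpace ℝ (Fin 3)} {δ : EuclideanSpace ℝ (Fin 3)}
    {w : Label → EuclideanSpace ℝ (Fin 3)} (hW : CellWindow A) (hδ : ShiftWindow A δ)
    (hw : (support w).Finite) {c : BondClass} (hc : c ∈ farClasses Rf Rinf) :
    -(farCoeff c * P c * N0 w) ≤ classTerm A B δ w c := by
  have hcn : c ∉ classesR Rf := (mem_farClasses.mp hc).2
  have h1 := TailStub.neg_farCoeff_mul_le (B := B) hRf hW hδ hw hcn
  have h2 : farCoeff c * plainForm c w ≤ farCoeff c * (P c * N0 w) :=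
    mul_le_mul_of_nonneg_left ((hmid c hc).2 w hw) (farCoeff_nonneg c)
  rw [mul_assoc]
  linarith

/-- **Beyond `R∞`:** `classTerm_c ≥ −farCoeff c · pathConst c · N0 w` (the landed far-bond bound at range `R∞` and
the path bound, `c` being non-diagonal). [folklore] -/
theorem neg_farCoeff_mul_pathConst_le (hC : ChainBound) (hP : PathBound) {Rinf : ℝ} (hRinf : 2 ≤ Rinf)
    {A B : EuclideanSpace ℝ (Fin 3) →L[ℝ] EuclideanSpace ℝ (Fin 3)} {δ : EuclideanSpace ℝ (Fin 3)}
    {w : Label → EuclideanSpace ℝ (Fin 3)} (hW : CellWindow A) (hδ : ShiftWindow A δ)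
    (hw : (support w).Finite) {c : BondClass} (hc : c ∉ classesR Rinf) :
    -(farCoeff c * pathConst c * N0 w) ≤ classTerm A B δ w c := by
  have hnd := not_diagClass_of_notMem (by linarith) hc
  have h1 := TailStub.neg_farCoeff_mul_le (B := B) hRinf hW hδ hw hc
  have h2 : farCoeff c * plainForm c w ≤ farCoeff c * (pathConst c * N0 w) :=
    mul_le_mul_of_nonneg_left (hP hC c hnd w hw) (farCoeff_nonneg c)
  rw [mul_assoc]
  linarith

/-- **Pointwise three-range bound:** minus the sum of the three charge families (chain charges on `(Rn, Rf]`,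
`farCoeff·P·N0` on `(Rf, R∞]`, `farCoeff·pathConst·N0` beyond `R∞`) is below the far class family
`𝟙[c ∉ classesR Rn]·classTerm_c`, class by class (the ranges are nested). [folklore] -/
theorem pointwise_bound (hC : ChainBound) (hP : PathBound) {Rn Rf Rinf : ℝ} (hRn : 2 ≤ Rn) (hRnf : Rn ≤ Rf)
    (hRfi : Rf ≤ Rinf) {chain : BondClass → List BondClass} (hvalid : ValidChains Rn Rf chain)
    {P : BondClass → ℝ} (hmid : MidBound Rf Rinf P)
    {A B : EuclideanSpace ℝ (Fin 3) →L[ℝ] EuclideanSpace ℝ (Fin 3)} {δ : EuclideanSpace ℝ (Fin 3)}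
    {w : Label → EuclideanSpace ℝ (Fin 3)} (hW : CellWindow A) (hδ : ShiftWindow A δ) (hw : (support w).Finite)
    (c : BondClass) :
    -((if c ∈ farClasses Rn Rf then |omegaLJ ‖A (bondVec δ c)‖| * chainCharge δ c (chain c) w else 0) +
        (if c ∈ farClasses Rf Rinf then farCoeff c * P c * N0 w else 0) +
        (if c ∈ classesR Rinf then 0 else farCoeff c * pathConst c) * N0 w) ≤
      if c ∈ classesR Rn then 0 else classTerm A B δ w c := by
  have hRf : 2 ≤ Rf := hRn.trans hRnf
  have hRinf : 2 ≤ Rinf := hRf.trans hRfi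
  by_cases h1 : c ∈ classesR Rn
  · have h2 : c ∈ classesR Rf := classesR_mono hRnf h1
    have h3 : c ∈ classesR Rinf := classesR_mono hRfi h2
    have hn1 : c ∉ farClasses Rn Rf := fun h => (mem_farClasses.mp h).2 h1
    have hn2 : c ∉ farClasses Rf Rinf := fun h => (mem_farClasses.mp h).2 h2
    simp [h1, h3, hn1, hn2]
  · by_cases h2 : c ∈ classesR Rf
    · have h3 : c ∈ classesR Rinf := classesR_mono hRfi h2
      have hm1 : c ∈ farClasses Rn Rf := mem_farClasses.mpr ⟨h2, h1⟩
      have hn2 : c ∉ farClasses Rf Rinf := fun h => (mem_farClasses.mp h).2 h2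
      rw [if_pos hm1, if_neg hn2, if_pos h3, if_neg h1]
      simp only [add_zero, zero_mul]
      exact neg_abs_mul_chainCharge_le hC hRn hvalid hW hδ hw hm1
    · have hn1 : c ∉ farClasses Rn Rf := fun h => h2 (mem_farClasses.mp h).1
      by_cases h3 : c ∈ classesR Rinf
      · have hm2 : c ∈ farClasses Rf Rinf := mem_farClasses.mpr ⟨h3, h2⟩
        rw [if_neg hn1, if_pos hm2, if_pos h3, if_neg h1]
        simp only [zero_add, zero_mul, add_zero]
        exact neg_farCoeff_mul_P_le hRf hmid hW hδ hw hm2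
      · have hn2 : c ∉ farClasses Rf Rinf := fun h => h3 (mem_farClasses.mp h).1
        rw [if_neg hn1, if_neg hn2, if_neg h3, if_neg h1]
        simp only [zero_add]
        exact neg_farCoeff_mul_pathConst_le hC hP hRinf hW hδ hw h3

/-! ## `tsum` bookkeeping -/

/-- Summing a pointwise bound `−(H₁ + H₂ + H₃) ≤ F` of summable families:
`−Σ' H₁ − Σ' H₂ − Σ' H₃ ≤ Σ' F`. [folklore] -/
theorem tsum_three_le {ι : Type*} {H₁ H₂ H₃ F : ι → ℝ} (h₁ : Summable H₁) (h₂ : Summable H₂)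
    (h₃ : Summable H₃) (hF : Summable F) (hle : ∀ i, -(H₁ i + H₂ i + H₃ i) ≤ F i) :
    -(∑' i, H₁ i) - (∑' i, H₂ i) - (∑' i, H₃ i) ≤ ∑' i, F i := by
  have key := Summable.tsum_le_tsum hle ((h₁.add h₂).add h₃).neg hF
  rw [tsum_neg, (h₁.add h₂).tsum_add h₃, h₁.tsum_add h₂] at key
  linarith

/-- A family vanishing off a finite set of classes is summable. [folklore] -/
theorem summable_ite_mem (s : Finset BondClass) (g : BondClass → ℝ) :
    Summable fun c => if c ∈ s then g c else 0 :=
  summable_of_hasFiniteSupport (s.finite_toSet.subset (by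
    intro c hc; by_contra h; exact hc (if_neg h)))

/-- Its sum is the finite sum. [folklore] -/
theorem tsum_ite_mem (s : Finset BondClass) (g : BondClass → ℝ) :
    ∑' c, (if c ∈ s then g c else 0) = ∑ c ∈ s, g c := by
  rw [tsum_eq_sum (s := s) (fun c hc => if_neg hc)]
  exact Finset.sum_congr rfl fun c hc => if_pos hc

/-! ## The stub -/

/-- **S10 — FAR CONTROL** (`stub_farControl`): the three-range far field in `tsum` form,
`−chargeSum Rn Rf chain A δ w − (Σ_{c ∈ farClasses Rf R∞} farCoeff c · P c)·N0 w − farTailConst R∞ · N0 w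
  ≤ Σ' c, 𝟙[c ∉ classesR Rn]·classTerm A B δ w c`
on the window, for `2 ≤ Rn ≤ Rf ≤ R∞`, a valid chain assignment, a mid-range assignment and a finitely supported
`w` with summable class family, given the chain bound and the path bound. [folklore] -/
theorem stub_farControl : FarControl := by
  intro hC hP Rn Rf Rinf hRn hRnf hRfi chain hvalid P hmid hT A B δ w hW hδ hw _ hsum
  -- the far family is the summable class family minus a finitely supported one
  have hfin : Summable fun c => if c ∈ classesR Rn then classTerm A B δ w c else 0 :=
    summable_ite_mem (classesR Rn) (classTerm A B δ w)
  have hfar : Summable fun c => if c ∈ classesR Rn then 0 else classTerm A B δ w c := by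
    have : (fun c => if c ∈ classesR Rn then 0 else classTerm A B δ w c) =
        fun c => classTerm A B δ w c - if c ∈ classesR Rn then classTerm A B δ w c else 0 := by
      funext c; split_ifs <;> simp
    rw [this]; exact hsum.sub hfin
  -- the three charge families
  have hs₁ := summable_ite_mem (farClasses Rn Rf)
    (fun c => |omegaLJ ‖A (bondVec δ c)‖| * chainCharge δ c (chain c) w)
  have hs₂ := summable_ite_mem (farClasses Rf Rinf) (fun c => farCoeff c * P c * N0 w)
  have hs₃ : Summable fun c => (if c ∈ classesR Rinf then 0 else farCoeff c * pathConst c) * N0 w :=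
    hT.mul_right _
  have ht₁ : ∑' c, (if c ∈ farClasses Rn Rf then |omegaLJ ‖A (bondVec δ c)‖| * chainCharge δ c (chain c) w
      else 0) = chargeSum Rn Rf chain A δ w :=
    tsum_ite_mem (farClasses Rn Rf) _
  have ht₂ : ∑' c, (if c ∈ farClasses Rf Rinf then farCoeff c * P c * N0 w else 0) =
      (∑ c ∈ farClasses Rf Rinf, farCoeff c * P c) * N0 w := by
    rw [tsum_ite_mem (farClasses Rf Rinf), Finset.sum_mul]
  have ht₃ : ∑' c, (if c ∈ classesR Rinf then 0 else farCoeff c * pathConst c) * N0 w =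
      farTailConst Rinf * N0 w := by
    unfold farTailConst
    exact tsum_mul_right
  have key := tsum_three_le hs₁ hs₂ hs₃ hfar
    (pointwise_bound hC hP hRn hRnf hRfi hvalid hmid (B := B) hW hδ hw)
  rw [ht₁, ht₂, ht₃] at key
  linarith

end Summit.AtomisticToContinuum.Crystallization.Theorems.PhononStabilityCWC.FarControlStub

end
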